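import Mathlib.Topology.Algebra.OpenSubgroup
import Literature.AnabelianGeometry.SemiGraphs.TemperedReconstructionEdgeMapProofs
import Literature.AnabelianGeometry.SemiGraphs.TemperedEdgeLikeDistinctProofs
import Literature.AnabelianGeometry.SemiGraphs.TemperedVerticialDistinctSameVertex
import HarnessLib

/-!
# Semi-graphs of anabelioids, §3: Corollary 3.9, step (b) — the edge map is compatible with the
# vertex map (toward residual R2 of the reduction)

Mochizuki, *Semi-graphs of anabelioids*, Publ. RIMS **42** (2006), §3, Corollary 3.9, proof, p. 42,
with Theorem 3.7 (ii), (iii), (iv) pp. 40–41 [cite: MochizukiSemiAnbd2006, Cor 3.9 p.42].  Proof-only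
(no definitions).  For a quasi-geometric `φ : π₁^temp(G) → π₁^temp(H)` between graphs of anabelioids
as in Cor. 3.9, the vertex map `f_V` (`existsUnique_vertexMap_of_isQuasiGeometric`) and the edge map
`f_E` (`existsUnique_edgeMap_of_isQuasiGeometric`) are COMPATIBLE: if `e` abuts to `v` then `f_E(e)`
abuts to `f_V(v)` (`edgeMap_abuts_vertexMap`), from Thm. 3.7 (i) `VerticialInjective`, (ii)
`verticialDistinct_holds` (PROVED in the tree), (iii) `CompactInVerticial`, (iv)
`MaximalCompactIffVerticial` (edge-like subgroups are infinite: abc-iut-L3-t11's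
`infinite_of_mem_edgeLikeSubgroups`).  Key lemma (print's "precisely two verticial
subgroups `Π_{v₁}`, `Π_{v₂}`, where `v₁`, `v₂` are the vertices joined by `e`", Thm. 3.7 (iii)):
`exists_verticial_pair_of_mem_edgeLikeSubgroups` — an edge-like subgroup of a closed edge with
branches `b₁ ≠ b₂` at `w₁`, `w₂` lies in two DISTINCT verticial subgroups at `w₁` and at `w₂`; for a
loop (`w₁ = w₂`) distinctness is total aloofness (the two branch subgroups of `Π_w` are not conjugate)
combined with commensurable terminality (Thm. 3.7 (ii), clause 2) and the injectivity of verticial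
homomorphisms (Thm. 3.7 (i)).  Nothing here takes a side on [IUTchIII] Cor. 3.12.
-/

open CategoryTheory Topology

namespace Literature.AnabelianGeometry.SemiGraphs

namespace ProfiniteSemiGraph

universe u

variable {𝒢 ℋ : ProfiniteSemiGraph.{u}}

/-! ### Small facts -/

/-- A verticial subgroup determines its vertex (Thm. 3.7 (ii), clause 1, PROVED in the tree).
[cite: MochizukiSemiAnbd2006, Thm 3.7(ii) p.40] -/
theorem vertex_eq_of_mem_verticialSubgroups (h𝒢 : 𝒢.Thm37Hypotheses) (c : TemperedPiChart 𝒢)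
    {v₁ v₂ : 𝒢.graph.Vertex} {H : Subgroup c.G} (h₁ : H ∈ verticialSubgroups c v₁)
    (h₂ : H ∈ verticialSubgroups c v₂) : v₁ = v₂ := by
  by_contra hne
  have h0 := (verticialDistinct_holds 𝒢 h𝒢 c).1 v₁ v₂ H H h₁ h₂ hne
  rw [Subgroup.relIndex_self] at h0
  exact one_ne_zero h0

/-- Commensurable terminality (Thm. 3.7 (ii), clause 2, PROVED in the tree): if `g H g⁻¹ = H` for a
verticial `H` then `g ∈ H`. [cite: MochizukiSemiAnbd2006, Thm 3.7(ii) p.40] -/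
theorem mem_of_map_conj_eq (h𝒢 : 𝒢.Thm37Hypotheses) (c : TemperedPiChart 𝒢) {v : 𝒢.graph.Vertex}
    {H : Subgroup c.G} (hH : H ∈ verticialSubgroups c v) {g : c.G}
    (hg : H.map (MulAut.conj g).toMonoidHom = H) : g ∈ H := by
  by_contra hg'
  have h0 := (verticialDistinct_holds 𝒢 h𝒢 c).2 v H hH 1 g (by simpa using hg')
  rw [hg, map_one] at h0
  have h1 : H.map (1 : MulAut c.G).toMonoidHom = H := by
    ext x; simp
  rw [h1, Subgroup.relIndex_self] at h0
  exact one_ne_zero h0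

/-- A subgroup of finite index (`relIndex ≠ 0`) in an infinite subgroup is nontrivial. [folklore] -/
private theorem ne_bot_of_relIndex_ne_zero {Γ : Type u} [Group Γ] {C L : Subgroup Γ} [Infinite L]
    (h : C.relIndex L ≠ 0) : C ≠ ⊥ := by
  rintro rfl
  rw [Subgroup.relIndex_bot_left, Nat.card_eq_zero_of_infinite] at h
  exact h rfl

/-! ### Edge homomorphisms versus branch subgroups -/

/-- For a branch `b` of `e` at `v`, an edge homomorphism `ψ` at `e` and a verticial homomorphism `φ` at
`v`: `g ψ(Π_e) g⁻¹ = φ(Π_b)` for some `g` (the gluing `S_e ≅ b^* S_v` and Prop. 3.2).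
[cite: MochizukiSemiAnbd2006, Thm 3.7(iii) p.41] -/
theorem exists_map_conj_range_eq (c : TemperedPiChart 𝒢) {e : 𝒢.graph.Edge} {b : 𝒢.graph.Branch}
    (hb : 𝒢.graph.edgeOf b = e) {v : 𝒢.graph.Vertex} (h : 𝒢.graph.abuts b = some v)
    {ψ : 𝒢.Ge e →ₜ* c.G} (hψ : IsEdgeHom c e ψ) {φ : 𝒢.Gv v →ₜ* c.G} (hφ : IsVerticialHom c v φ) :
    ∃ g : c.G, ψ.toMonoidHom.range.map (MulAut.conj g).toMonoidHom =
      (𝒢.branchSubgroup b v h).map φ.toMonoidHom := by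
  subst hb
  obtain ⟨iE⟩ := hψ
  obtain ⟨iV⟩ := hφ
  obtain ⟨i⟩ := nonempty_res_iso_res_comp_brHom c b v h ψ φ iE iV
  obtain ⟨g, hg, -⟩ := BTemp.exists_conj_of_natTrans c.isTempered ψ (φ.comp (𝒢.brHom b v h)) i.hom
  refine ⟨g, ?_⟩
  ext x
  constructor
  · rintro ⟨_, ⟨a, rfl⟩, rfl⟩
    exact ⟨𝒢.brHom b v h a, ⟨a, rfl⟩, (hg a).symm⟩
  · rintro ⟨_, ⟨a, rfl⟩, rfl⟩
    exact ⟨ψ a, ⟨a, rfl⟩, hg a⟩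

/-- **An edge-like subgroup of a closed edge lies in two DISTINCT verticial subgroups at the vertices
of its two branches** ([SemiAnbd] Thm. 3.7 (iii): "precisely two verticial subgroups `Π_{v₁}`,
`Π_{v₂}`, where `v₁`, `v₂` are the vertices joined by `e`"); for a loop the two are distinct
conjugates of one verticial subgroup, by total aloofness, commensurable terminality and the
injectivity of verticial homomorphisms. [cite: MochizukiSemiAnbd2006, Thm 3.7(iii) p.41] -/
theorem exists_verticial_pair_of_mem_edgeLikeSubgroups (h37i : VerticialInjective.{u})
    (hℋ : Cor39Hypotheses ℋ) (c : TemperedPiChart ℋ) {e : ℋ.graph.Edge} {b₁ b₂ : ℋ.graph.Branch}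
    (hb : b₁ ≠ b₂) (hb₁ : ℋ.graph.edgeOf b₁ = e) (hb₂ : ℋ.graph.edgeOf b₂ = e)
    {w₁ w₂ : ℋ.graph.Vertex} (hw₁ : ℋ.graph.abuts b₁ = some w₁) (hw₂ : ℋ.graph.abuts b₂ = some w₂)
    {L : Subgroup c.G} (hL : L ∈ edgeLikeSubgroups c e) :
    ∃ H₁ ∈ verticialSubgroups c w₁, ∃ H₂ ∈ verticialSubgroups c w₂, H₁ ≠ H₂ ∧ L ≤ H₁ ∧ L ≤ H₂ := by
  have h37 := hℋ.thm37Hypotheses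
  obtain ⟨ψ, hψ, rfl⟩ := hL
  -- `L ≤ g⁻¹ φ(Π_w) g` whenever `g L g⁻¹ = φ(Π_b)`
  have hle : ∀ {w : ℋ.graph.Vertex} {b : ℋ.graph.Branch} (hw : ℋ.graph.abuts b = some w)
      (φ : ℋ.Gv w →ₜ* c.G) (g : c.G),
      ψ.toMonoidHom.range.map (MulAut.conj g).toMonoidHom =
        (ℋ.branchSubgroup b w hw).map φ.toMonoidHom →
      ψ.toMonoidHom.range ≤ φ.toMonoidHom.range.map (MulAut.conj g⁻¹).toMonoidHom := by
    intro w b hw φ g hg x hx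
    have hx' : g * x * g⁻¹ ∈ (ℋ.branchSubgroup b w hw).map φ.toMonoidHom := hg ▸ ⟨x, hx, rfl⟩
    obtain ⟨y, -, hy⟩ := hx'
    refine ⟨φ y, ⟨y, rfl⟩, ?_⟩
    change g⁻¹ * φ.toMonoidHom y * g⁻¹⁻¹ = x
    rw [hy]; group
  by_cases hw : w₁ = w₂
  · -- a loop (or two branches at one vertex): ONE verticial homomorphism `φ` at `w`, two conjugators
    subst hw
    obtain ⟨⟨_, φ, hφ, rfl⟩, hinj⟩ := h37i ℋ h37 c w₁
    obtain ⟨g₁, hg₁⟩ := exists_map_conj_range_eq c hb₁ hw₁ hψ hφ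
    obtain ⟨g₂, hg₂⟩ := exists_map_conj_range_eq c hb₂ hw₂ hψ hφ
    refine ⟨_, conj_mem_verticialSubgroups c ⟨φ, hφ, rfl⟩ g₁⁻¹, _,
      conj_mem_verticialSubgroups c ⟨φ, hφ, rfl⟩ g₂⁻¹, fun heq => ?_, hle hw₁ φ g₁ hg₁,
      hle hw₂ φ g₂ hg₂⟩
    -- `h := g₂ g₁⁻¹` normalises `H₀ = φ(Π_w)`, hence lies in it (commensurable terminality)
    have hmem : ∀ (g : c.G) (y : c.G),
        y ∈ φ.toMonoidHom.range.map (MulAut.conj g⁻¹).toMonoidHom ↔ g * y * g⁻¹ ∈ φ.toMonoidHom.range := by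
      intro g y
      rw [Subgroup.mem_map_equiv, MulAut.conj_symm_apply, inv_inv]
    have hH : φ.toMonoidHom.range.map (MulAut.conj (g₂ * g₁⁻¹)).toMonoidHom = φ.toMonoidHom.range := by
      ext x
      rw [Subgroup.mem_map_equiv, MulAut.conj_symm_apply]
      have := SetLike.ext_iff.mp heq (g₂⁻¹ * x * g₂)
      rw [hmem, hmem] at this
      have e1 : g₁ * (g₂⁻¹ * x * g₂) * g₁⁻¹ = (g₂ * g₁⁻¹)⁻¹ * x * (g₂ * g₁⁻¹) := by group
      have e2 : g₂ * (g₂⁻¹ * x * g₂) * g₂⁻¹ = x := by group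
      rw [e1, e2] at this
      exact this
    obtain ⟨γ₀, hγ₀⟩ : g₂ * g₁⁻¹ ∈ φ.toMonoidHom.range := mem_of_map_conj_eq h37 c ⟨φ, hφ, rfl⟩ hH
    -- `φ(Π_{b₂}) = φ(γ₀ Π_{b₁} γ₀⁻¹)`
    have hmemψ : ∀ (g : c.G) (z : c.G), z ∈ ψ.toMonoidHom.range.map (MulAut.conj g).toMonoidHom ↔
        g⁻¹ * z * g ∈ ψ.toMonoidHom.range := by
      intro g z
      rw [Subgroup.mem_map_equiv, MulAut.conj_symm_apply]
    have hcomm : φ.toMonoidHom.comp (MulAut.conj γ₀).toMonoidHom =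
        (MulAut.conj (g₂ * g₁⁻¹)).toMonoidHom.comp φ.toMonoidHom := by
      ext x
      show φ (γ₀ * x * γ₀⁻¹) = (g₂ * g₁⁻¹) * φ x * (g₂ * g₁⁻¹)⁻¹
      have hγ : (φ γ₀ : c.G) = g₂ * g₁⁻¹ := hγ₀
      rw [map_mul, map_mul, map_inv, hγ]
    have hPb : (ℋ.branchSubgroup b₂ w₁ hw₂).map φ.toMonoidHom =
        ((ℋ.branchSubgroup b₁ w₁ hw₁).map (MulAut.conj γ₀).toMonoidHom).map φ.toMonoidHom := by
      rw [Subgroup.map_map, hcomm, ← Subgroup.map_map, ← hg₁, ← hg₂]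
      ext z
      rw [hmemψ, Subgroup.mem_map_equiv, MulAut.conj_symm_apply, hmemψ]
      have e3 : g₁⁻¹ * ((g₂ * g₁⁻¹)⁻¹ * z * (g₂ * g₁⁻¹)) * g₁ = g₂⁻¹ * z * g₂ := by group
      rw [e3]
    have hPb' : ℋ.branchSubgroup b₂ w₁ hw₂ =
        (ℋ.branchSubgroup b₁ w₁ hw₁).map (MulAut.conj γ₀).toMonoidHom :=
      Subgroup.map_injective (hinj φ hφ) hPb
    -- contradiction with total aloofness at the edge of `b₂`
    have h0 := hℋ.isTotallyAloof (ℋ.graph.edgeOf b₂) b₂ rfl w₁ hw₂ b₁ hw₁ γ₀ (Or.inl hb)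
    rw [← hPb', Subgroup.relIndex_self] at h0
    exact one_ne_zero h0
  · -- two distinct vertices: any verticial subgroups through the branches, distinct by their vertices
    obtain ⟨⟨_, φ₁, hφ₁, rfl⟩, -⟩ := h37i ℋ h37 c w₁
    obtain ⟨⟨_, φ₂, hφ₂, rfl⟩, -⟩ := h37i ℋ h37 c w₂
    obtain ⟨g₁, hg₁⟩ := exists_map_conj_range_eq c hb₁ hw₁ hψ hφ₁
    obtain ⟨g₂, hg₂⟩ := exists_map_conj_range_eq c hb₂ hw₂ hψ hφ₂
    refine ⟨_, conj_mem_verticialSubgroups c ⟨φ₁, hφ₁, rfl⟩ g₁⁻¹, _,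
      conj_mem_verticialSubgroups c ⟨φ₂, hφ₂, rfl⟩ g₂⁻¹, fun heq => hw ?_, hle hw₁ φ₁ g₁ hg₁,
      hle hw₂ φ₂ g₂ hg₂⟩
    exact vertex_eq_of_mem_verticialSubgroups h37 c
      (conj_mem_verticialSubgroups c ⟨φ₁, hφ₁, rfl⟩ g₁⁻¹)
      (heq ▸ conj_mem_verticialSubgroups c ⟨φ₂, hφ₂, rfl⟩ g₂⁻¹)

/-! ### The edge map is compatible with the vertex map -/

/-- **`f_E(e)` abuts to `f_V(v)` whenever `e` abuts to `v`** ([SemiAnbd] Cor. 3.9, proof, p. 42: the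
maps on vertices and edges determined by a quasi-geometric `φ` form "a morphism of graphs"), from
Thm. 3.7 (i)–(iii): `φ` carries a nontrivial edge-like `L ≤ K_v` to `φ(L)`, open
in an (infinite) edge-like `L₂` at `f_E(e)` and contained in a verticial `K₂` at `f_V(v)`; `L₂` lies
in two distinct verticial subgroups at the end-vertices of `f_E(e)`
(`exists_verticial_pair_of_mem_edgeLikeSubgroups`), and a nontrivial compact subgroup lies in at most
two verticial subgroups (Thm. 3.7 (iii)), so `K₂` is one of them. [cite: MochizukiSemiAnbd2006, Cor 3.9 p.42] -/
theorem edgeMap_abuts_vertexMap (h37i : VerticialInjective.{u}) (h37iii : CompactInVerticial.{u})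
    (hℋ : Cor39Hypotheses ℋ) (c𝒢 : TemperedPiChart 𝒢) (cℋ : TemperedPiChart ℋ)
    (φ : c𝒢.G →ₜ* cℋ.G) {e : 𝒢.graph.Edge} {L K : Subgroup c𝒢.G}
    (hL : L ∈ edgeLikeSubgroups c𝒢 e) (hLK : L ≤ K)
    {e' : ℋ.graph.Edge} {w : ℋ.graph.Vertex} {L₂ K₂ : Subgroup cℋ.G}
    (hL₂ : L₂ ∈ edgeLikeSubgroups cℋ e') (hmapsL : MapsOntoOpenSubgroupOf φ.toMonoidHom L L₂)
    (hK₂ : K₂ ∈ verticialSubgroups cℋ w) (hmapsK : K.map φ.toMonoidHom ≤ K₂) :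
    ℋ.graph.EdgeAbuts e' w := by
  haveI := cℋ.t2Space
  have h37 := hℋ.thm37Hypotheses
  -- the two branches of the closed edge `e'`
  obtain ⟨b₁, b₂, hb, hb₁, hb₂, -⟩ := ℋ.graph.two_branches e'
  obtain ⟨w₁, hw₁⟩ := Option.isSome_iff_exists.mp (hℋ.isGraph.abuts_isSome b₁)
  obtain ⟨w₂, hw₂⟩ := Option.isSome_iff_exists.mp (hℋ.isGraph.abuts_isSome b₂)
  obtain ⟨H₁, hH₁, H₂, hH₂, hne, hL₂H₁, hL₂H₂⟩ :=
    exists_verticial_pair_of_mem_edgeLikeSubgroups h37i hℋ cℋ hb hb₁ hb₂ hw₁ hw₂ hL₂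
  -- `C := φ(L)`: compact, nontrivial, in `K₂`, `H₁`, `H₂`
  have hC : IsCompact ((L.map φ.toMonoidHom : Subgroup cℋ.G) : Set cℋ.G) := by
    rw [Subgroup.coe_map]
    exact (isCompact_of_mem_edgeLikeSubgroups c𝒢 hL).image φ.continuous
  haveI : Infinite L₂ := infinite_of_mem_edgeLikeSubgroups h37i h37 cℋ hL₂
  have hC0 : L.map φ.toMonoidHom ≠ ⊥ :=
    ne_bot_of_relIndex_ne_zero
      (relIndex_ne_zero_of_mapsOnto φ.toMonoidHom (isCompact_of_mem_edgeLikeSubgroups cℋ hL₂) hmapsL)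
  have hCK₂ : L.map φ.toMonoidHom ≤ K₂ := (Subgroup.map_mono hLK).trans hmapsK
  have hCH₁ : L.map φ.toMonoidHom ≤ H₁ := hmapsL.1.trans hL₂H₁
  have hCH₂ : L.map φ.toMonoidHom ≤ H₂ := hmapsL.1.trans hL₂H₂
  obtain ⟨hall, -⟩ := (h37iii ℋ h37 cℋ _ hC).2 hC0 w₁ w₂ H₁ H₂ hH₁ hH₂ hne hCH₁ hCH₂
  rcases hall w K₂ hK₂ hCK₂ with rfl | rfl
  · exact ⟨b₁, hb₁, (vertex_eq_of_mem_verticialSubgroups h37 cℋ hK₂ hH₁) ▸ hw₁⟩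
  · exact ⟨b₂, hb₂, (vertex_eq_of_mem_verticialSubgroups h37 cℋ hK₂ hH₂) ▸ hw₂⟩

/-- **Compatibility of the maps of Cor. 3.9 (b)**: with `f_V`, `f_E` the vertex and edge maps
determined by a quasi-geometric `φ` (`existsUnique_vertexMap_of_isQuasiGeometric`,
`existsUnique_edgeMap_of_isQuasiGeometric`), every edge `e` abutting to `v` has `f_E(e)` abutting to
`f_V(v)`. [cite: MochizukiSemiAnbd2006, Cor 3.9 p.42] -/
theorem edgeMap_abuts_vertexMap_of_isQuasiGeometric (h37i : VerticialInjective.{u})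
    (h37iii : CompactInVerticial.{u}) (h𝒢 : Cor39Hypotheses 𝒢) (hℋ : Cor39Hypotheses ℋ)
    (c𝒢 : TemperedPiChart 𝒢) (cℋ : TemperedPiChart ℋ) (φ : c𝒢.G →ₜ* cℋ.G)
    {fV : 𝒢.graph.Vertex → ℋ.graph.Vertex} {fE : 𝒢.graph.Edge → ℋ.graph.Edge}
    (hfV : ∀ (v : 𝒢.graph.Vertex) (K : Subgroup c𝒢.G), K ∈ verticialSubgroups c𝒢 v →
      ∃ K₂ ∈ verticialSubgroups cℋ (fV v), MapsOntoOpenSubgroupOf φ.toMonoidHom K K₂)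
    (hfE : ∀ (e : 𝒢.graph.Edge) (L : Subgroup c𝒢.G), L ∈ edgeLikeSubgroups c𝒢 e →
      ∃ L₂ ∈ edgeLikeSubgroups cℋ (fE e), MapsOntoOpenSubgroupOf φ.toMonoidHom L L₂)
    {b : 𝒢.graph.Branch} {v : 𝒢.graph.Vertex} (hbv : 𝒢.graph.abuts b = some v) :
    ℋ.graph.EdgeAbuts (fE (𝒢.graph.edgeOf b)) (fV v) := by
  obtain ⟨L, hL, -⟩ := exists_mem_edgeLikeSubgroups_ne_bot h37i h𝒢 c𝒢 (𝒢.graph.edgeOf b)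
  obtain ⟨K, hK, hLK⟩ :=
    exists_mem_verticialSubgroups_ge c𝒢 hbv hL (h37i 𝒢 h𝒢.thm37Hypotheses c𝒢 v).1
  obtain ⟨K₂, hK₂, hmapsK⟩ := hfV v K hK
  obtain ⟨L₂, hL₂, hmapsL⟩ := hfE (𝒢.graph.edgeOf b) L hL
  exact edgeMap_abuts_vertexMap h37i h37iii hℋ c𝒢 cℋ φ hL hLK hL₂ hmapsL hK₂ hmapsK.1

end ProfiniteSemiGraph

end Literature.AnabelianGeometry.SemiGraphs
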